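import Literature.AlgebraicGeometry.ShimuraVarieties.HeckeCorrespondenceAction
import Mathlib.Topology.Algebra.ConstMulAction

/-!
# Hecke admissibility of every isometry, from proper discontinuity (crux
# `EndoscopicMiddleDegree.OrthogonalEnveloped`, stmt-HodgeConjecture-14300; `--supports`; seat c2, 2026-08-16)

`D.IsHeckeAdmissible g` (the Hecke operator `T_g` is the genuine transfer-pull-back, not the junk `0`) is
`g ∈ U(V)(F) ∧ [Γ : N_g] < ∞ ∧ (N_g \ 𝔹 → X(ℂ) is a covering)`. This file composes the LANDED bricks —
finite index of Hecke levels (`stub_finiteIndexHeckeLevel`, p108444), level covers are coverings given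
free + properly discontinuous + locally compact T2 (`stub_levelCoveringOfProperlyDiscontinuous`, p107526),
freeness from proper discontinuity and torsion-freeness (`stub_freeOfProperlyDiscontinuous`, p107635), the
point-set topology of the ball (`stub_ballLocallyCompactT2`, p107937) — with the one remaining arithmetic
input `stub_properlyDiscontinuous` (⟸ `stub_cornerBound` alone, via p108067/p108471/p108331/p108224/
p108321/p107948), all taken as hypotheses (their modules are not yet served to importing files):
EVERY `g ∈ U(V)(F)` is Hecke admissible.

* `stub_heckeAdmissibleOfInputs` (REGISTERED stub of the crux).

References: G. Shimura, *Introduction to the Arithmetic Theory of Automorphic Functions* (1971), §3.1, §7.2;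
BMM arXiv:1306.1515 Part 2 §1.4.
-/

noncomputable section

-- The crux-workfile namespace `Summit.<P>.<Sub>.Cruxes.…` repeats `HodgeConjecture` (single-conjunct summit).
set_option linter.dupNamespace false

namespace Summit.HodgeConjecture.HodgeConjecture.Cruxes.OrthogonalEnveloped.HeckeGraphChow

open Literature.AlgebraicGeometry.Motives (SchemeOver)
open Literature.AlgebraicGeometry.ShimuraVarieties

/-- **REGISTERED STUB `stub_heckeAdmissibleOfInputs` (seat c2): every isometry is Hecke admissible, given
proper discontinuity of `Γ` on the ball and the four landed bricks.**
[cite: Shimura1973, §3.1 and §7.2] [cite: BergeronMillsonMoeglin2016Balls, Part 2 §1.4] -/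
theorem stub_heckeAdmissibleOfInputs :
    (∀ {p : ℕ} {X : SchemeOver ℂ} (D : UnitaryBallQuotientDatum p X),
          ProperlyDiscontinuousSMul ↥D.Γ D.ball) →
    (∀ {p : ℕ} {X : SchemeOver ℂ} (D : UnitaryBallQuotientDatum p X)
          [ProperlyDiscontinuousSMul ↥D.Γ D.ball], IsCancelSMul ↥D.Γ D.ball) →
    (∀ {p : ℕ} {X : SchemeOver ℂ} (D : UnitaryBallQuotientDatum p X),
          LocallyCompactSpace D.ball ∧ T2Space D.ball) →
    (∀ {p : ℕ} {X : SchemeOver ℂ} (D : UnitaryBallQuotientDatum p X) (g : GL (Fin (p + 1)) D.E),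
          g ∈ unitaryGroup (conjRingHom D.E) D.H → (D.heckeLevel g).FiniteIndex) →
    (∀ {p : ℕ} {X : SchemeOver ℂ} (D : UnitaryBallQuotientDatum p X)
          [ProperlyDiscontinuousSMul ↥D.Γ D.ball] [IsCancelSMul ↥D.Γ D.ball]
          [LocallyCompactSpace D.ball] [T2Space D.ball] (N : Subgroup ↥D.Γ) [N.Normal],
          IsCoveringMap (D.levelProj N)) →
    ∀ {p : ℕ} {X : SchemeOver ℂ} (D : UnitaryBallQuotientDatum p X) (g : GL (Fin (p + 1)) D.E),
      g ∈ unitaryGroup (conjRingHom D.E) D.H → D.IsHeckeAdmissible g := by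
  intro hpd hfree hball hfin hcov p X D g hg
  haveI : ProperlyDiscontinuousSMul ↥D.Γ D.ball := hpd D
  haveI : IsCancelSMul ↥D.Γ D.ball := hfree D
  haveI : LocallyCompactSpace D.ball := (hball D).1
  haveI : T2Space D.ball := (hball D).2
  exact ⟨hg, hfin D g hg, hcov D (D.heckeLevel g)⟩

end Summit.HodgeConjecture.HodgeConjecture.Cruxes.OrthogonalEnveloped.HeckeGraphChow

end
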